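import Mathlib

/-!
# Route `GreenTaoLevelTwo`, crux `MNTwo` (stmt-Parity-21276), line `birth`, stub `stub_mnVertical`:
# regrouping fifteen cutoffs and a split character into four bounded functions (GT 2008b §10)

Tool for block V4 / H3 (= AIF §10 Lemma 24 "Type II sum implies major arc", the step "we observe by
inspection that fourty-seven of these cutoffs depend on at most three of the variables
`l₁,l₂,m₁,m₂` … By the quadratic nature of `P` we may absorb the terms `χ(g^{P(l₀+l₁+l₂,m₀+m₁+m₂)})`
and `e(kP(l₀+l₁+l₂,m₀+m₁+m₂))` into the four unspecified bounded functions `b()`") of the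
`stub_mnVertical` census (B. Green, T. Tao, *Quadratic uniformity of the Möbius function*, Ann.
Inst. Fourier 58 (2008) = arXiv:math/0606087, §10).  Def-free, explicit: with the fifteen real
cutoffs `wt(·,·)` (all but the vertex `(l₀+l₂+l₁, m₀+m₂+m₁)`, in the nesting of
`…MNTwoTypeIISecondCS.second_cs_pigeonhole`, normalised so that `|wt| ≤ 1`), two extra real factors
`χ₁(l₁,l₂), χ₂(m₁,m₂)` bounded by `1`, and the character `e(β·P(l₀+l₂+l₁, m₀+m₂+m₁))`,
`P(l,m) = (d+sl)(w+tm)`, the product is `b₁(l₂,m₁,m₂) b₂(l₁,m₁,m₂) b₃(l₁,l₂,m₂) b₄(l₁,l₂,m₁)` with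
`1`-bounded `bₖ` — the input shape of `…MNTwoBoxPhase.norm_pow_sixteen_quadrilinear_le`.

* `box_regroup` — existence of the four bounded functions with the pointwise identity.

References: [GreenTao2008QuadraticMobius] arXiv:math/0606087 §10 (proof of Lemma 24).
-/

open scoped FourierTransform

namespace Summit.Parity.GeneralizedHardyLittlewood.GreenTaoLevelTwoMNTwoBoxRegroup

/-- `‖(x : ℂ)‖ ≤ 1` when `|x| ≤ 1`. [folklore] -/
theorem norm_le_one' {x : ℝ} (hx : |x| ≤ 1) : ‖((x : ℝ) : ℂ)‖ ≤ 1 := by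
  rw [Complex.norm_real, Real.norm_eq_abs]; exact hx

/-- `‖a‖ ≤ 1 → ‖b‖ ≤ 1 → ‖ab‖ ≤ 1` in `ℂ`. [folklore] -/
theorem norm_mul_le_one' {a b : ℂ} (ha : ‖a‖ ≤ 1) (hb : ‖b‖ ≤ 1) : ‖a * b‖ ≤ 1 := by
  rw [norm_mul]; exact mul_le_one₀ ha (norm_nonneg _) hb

/-- **Regrouping into four bounded functions (GT 2008b §10, Lemma 24).**  See the module
docstring. [cite: GreenTao2008QuadraticMobius, §10 (proof of Lemma 24)] -/
theorem box_regroup (wt : ℤ → ℤ → ℝ) (hwt : ∀ l m, |wt l m| ≤ 1)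
    (χ₁ χ₂ : ℤ → ℤ → ℝ) (hχ₁ : ∀ x y, |χ₁ x y| ≤ 1) (hχ₂ : ∀ x y, |χ₂ x y| ≤ 1)
    (β : ℝ) (d w s t l₀ m₀ : ℤ) :
    ∃ b₁ b₂ b₃ b₄ : ℤ → ℤ → ℤ → ℂ,
      (∀ x y z, ‖b₁ x y z‖ ≤ 1) ∧ (∀ x y z, ‖b₂ x y z‖ ≤ 1) ∧ (∀ x y z, ‖b₃ x y z‖ ≤ 1) ∧
      (∀ x y z, ‖b₄ x y z‖ ≤ 1) ∧
      ∀ (l₁ m₁ l₂ m₂ : ℤ) (g : ℂ),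
        (((wt l₀ m₀ * wt l₀ (m₀ + m₁) * wt (l₀ + l₁) m₀ * wt (l₀ + l₁) (m₀ + m₁)) *
            (wt l₀ (m₀ + m₂) * wt l₀ (m₀ + m₂ + m₁) * wt (l₀ + l₁) (m₀ + m₂) *
              wt (l₀ + l₁) (m₀ + m₂ + m₁)) *
            (wt (l₀ + l₂) m₀ * wt (l₀ + l₂) (m₀ + m₁) * wt (l₀ + l₂ + l₁) m₀ *
              wt (l₀ + l₂ + l₁) (m₀ + m₁)) *
            (wt (l₀ + l₂) (m₀ + m₂) * wt (l₀ + l₂) (m₀ + m₂ + m₁) * wt (l₀ + l₂ + l₁) (m₀ + m₂)) *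
            χ₁ l₁ l₂ * χ₂ m₁ m₂ : ℝ) : ℂ) *
          (𝐞 (β * ((d + s * (l₀ + l₂ + l₁)) * (w + t * (m₀ + m₂ + m₁)) : ℤ)) : ℂ) * g =
        b₁ l₂ m₁ m₂ * b₂ l₁ m₁ m₂ * b₃ l₁ l₂ m₂ * b₄ l₁ l₂ m₁ * g := by
  -- the four bounded functions
  refine ⟨fun l₂ m₁ m₂ =>
      ((wt l₀ m₀ : ℝ) : ℂ) * ((wt l₀ (m₀ + m₁) : ℝ) : ℂ) * ((wt l₀ (m₀ + m₂) : ℝ) : ℂ) *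
      ((wt l₀ (m₀ + m₂ + m₁) : ℝ) : ℂ) * ((wt (l₀ + l₂) m₀ : ℝ) : ℂ) *
      ((wt (l₀ + l₂) (m₀ + m₁) : ℝ) : ℂ) * ((wt (l₀ + l₂) (m₀ + m₂) : ℝ) : ℂ) *
      ((wt (l₀ + l₂) (m₀ + m₂ + m₁) : ℝ) : ℂ) * ((χ₂ m₁ m₂ : ℝ) : ℂ) *
      (𝐞 (β * ((d + s * (l₀ + l₂) : ℤ) : ℝ) * ((w + t * (m₀ + m₂ + m₁) : ℤ) : ℝ)) : ℂ),
    fun l₁ m₁ m₂ =>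
      ((wt (l₀ + l₁) m₀ : ℝ) : ℂ) * ((wt (l₀ + l₁) (m₀ + m₁) : ℝ) : ℂ) *
      ((wt (l₀ + l₁) (m₀ + m₂) : ℝ) : ℂ) * ((wt (l₀ + l₁) (m₀ + m₂ + m₁) : ℝ) : ℂ) *
      (𝐞 (β * ((s * l₁ : ℤ) : ℝ) * ((w + t * (m₀ + m₂ + m₁) : ℤ) : ℝ)) : ℂ),
    fun l₁ l₂ m₂ =>
      ((wt (l₀ + l₂ + l₁) m₀ : ℝ) : ℂ) * ((wt (l₀ + l₂ + l₁) (m₀ + m₂) : ℝ) : ℂ) *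
      ((χ₁ l₁ l₂ : ℝ) : ℂ),
    fun l₁ l₂ m₁ => ((wt (l₀ + l₂ + l₁) (m₀ + m₁) : ℝ) : ℂ),
    ?_, ?_, ?_, ?_, ?_⟩
  · intro x y z
    refine norm_mul_le_one' (norm_mul_le_one' (norm_mul_le_one' (norm_mul_le_one'
      (norm_mul_le_one' (norm_mul_le_one' (norm_mul_le_one' (norm_mul_le_one' (norm_mul_le_one'
      (norm_le_one' (hwt _ _)) (norm_le_one' (hwt _ _))) (norm_le_one' (hwt _ _)))
      (norm_le_one' (hwt _ _))) (norm_le_one' (hwt _ _))) (norm_le_one' (hwt _ _)))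
      (norm_le_one' (hwt _ _))) (norm_le_one' (hwt _ _))) ?_) ?_
    · rw [Complex.norm_real, Real.norm_eq_abs]; exact hχ₂ _ _
    · exact (Circle.norm_coe _).le
  · intro x y z
    refine norm_mul_le_one' (norm_mul_le_one' (norm_mul_le_one' (norm_mul_le_one'
      (norm_le_one' (hwt _ _)) (norm_le_one' (hwt _ _))) (norm_le_one' (hwt _ _)))
      (norm_le_one' (hwt _ _))) ?_
    exact (Circle.norm_coe _).le
  · intro x y z
    refine norm_mul_le_one' (norm_mul_le_one' (norm_le_one' (hwt _ _))
      (norm_le_one' (hwt _ _))) ?_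
    rw [Complex.norm_real, Real.norm_eq_abs]; exact hχ₁ _ _
  · intro x y z
    exact norm_le_one' (hwt _ _)
  · intro l₁ m₁ l₂ m₂ g
    -- the character splits: `e(β P(v₁₆)) = e(β(d+s(l₀+l₂))(w+t(m₀+m₂+m₁))) · e(β s l₁ (w+t(m₀+m₂+m₁)))`
    have hsplit : (𝐞 (β * ((d + s * (l₀ + l₂ + l₁)) * (w + t * (m₀ + m₂ + m₁)) : ℤ)) : ℂ) =
        (𝐞 (β * ((d + s * (l₀ + l₂) : ℤ) : ℝ) * ((w + t * (m₀ + m₂ + m₁) : ℤ) : ℝ)) : ℂ) *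
          (𝐞 (β * ((s * l₁ : ℤ) : ℝ) * ((w + t * (m₀ + m₂ + m₁) : ℤ) : ℝ)) : ℂ) := by
      rw [← Circle.coe_mul, ← AddChar.map_add_eq_mul]
      congr 2
      push_cast
      ring
    rw [hsplit]
    push_cast
    ring

end Summit.Parity.GeneralizedHardyLittlewood.GreenTaoLevelTwoMNTwoBoxRegroup
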